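import Summits.Ventures.YMGap.RobustBall.Targets
import Summits.Ventures.YMGap.RobustBall.PerturbedOneLink
import Literature.MathematicalPhysics.QuantumFieldTheory.PlaquetteWeightTorusDobrushin
import HarnessLib

/-!
# Venture YMGap, track ROBUST-BALL (Y2) — the perturbed TORUS specification: Gibbs property and
the one-link law (targets U0, U0′ of `RobustBall/Targets`)

HONEST FRAMING. WHAT THIS IS: a venture file (cell `pub-ymgap`, track Y2 ROBUST-BALL, seat ds-2): the
torus twin of rb-p1's `PerturbedOneLink` for the carrier of the ball, the tree's quasi-local
gauge-invariant perturbations `W = (W_X)_X` of the torus Wilson action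
(`QuasiLocalGaugePerturbation d L SU(N) 1`). For the perturbed torus specification
`perturbedTorusSpec W β` of `RobustBall/Defs` (product Haar glued with the boundary condition, tilted
by `∑_q log v_β(U_q) − W.total`) it proves: (i) it IS a specification and the member's torus measure
`W.perturbedMeasure (fundamentalRep (Fin N)) β ∝ exp(−β S_W − W) ∏ dU_e` is a Gibbs measure for it
(the DLR equations on the finite torus = consistency in the full volume); (ii) **U0** — its one-link
conditional law at `e` under the boundary condition `η` is the 't Hooft law `ν_{B_η}`
(`∝ exp(N Re tr(g B_η)) dg`, `B_η = tField β e η`) RE-WEIGHTED by `exp(−h_{W,e,η})` with the local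
re-weighting function `h_{W,e,η}(g) = localTilt W e η g = ∑_{X ∋ e} W_X(η^{e←g})` (polymers not through
`e` only shift the energy by a `g`-independent constant, which the normalisation forgets);
(iii) **U0′** — the LOADS of a `LoadWitness` control `h`: oscillation `≤ a(e) = oscLoad 0 e`,
Lipschitz constant in `g` `≤ ℓ_s(e) = selfLipLoad 0 e`, and for boundary conditions `ω = η` off a link
`y ≠ e`, `sup_g |h_ω(g) − h_η(g)| ≤ ℓ(e,y) · ‖ω_y − η_y‖_F` with `ℓ(e,y) = crossLip 0 e y`.
Hence `siteLawTarget_holds : SiteLawTarget N d` and `localTiltLoadsTarget_holds : LocalTiltLoadsTarget N d`.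
WHAT THIS IS NOT: no Dobrushin matrix, no row sum, no number (that is `TorusDoor`), no clustering
statement (`TorusClustering`); strong-coupling LATTICE bookkeeping on a finite torus only — no
continuum statement, no claim about the Yang–Mills Millennium problem.

## References
* H.-O. Georgii, *Gibbs Measures and Phase Transitions* (2011), Def. 1.23 / Rem. 1.24, Def. 2.9.
* S. Friedli, Y. Velenik (2017), §6.10.1 (Gibbsian specifications with an a priori measure).
* H. Föllmer, LNM 1362 (1988), Ch. I §2.1 (one-site kernels), (2.20).
* The tree: `PlaquetteWeightTorusSpecification.lean` (`torusWeightSpec`, the `W = 0` template),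
  `PlaquetteWeightTorusDobrushin.lean` (`torusLogWeight_update_eq`), `StrongCouplingTorusWindow.lean`
  (`localLogWeight_update_eq`, `siteLaw_torusWilson_thooft`), rb-p1's `RobustBall/PerturbedOneLink.lean`
  (`siteLaw_tilted_map_glueWith_pi`, the `ℤ^d` twin).
-/

noncomputable section

open MeasureTheory ProbabilityTheory Finset Function Real
open Literature.Probability.LatticeModels Literature.Probability.LatticeModels.DobrushinMetric
open Literature.MathematicalPhysics.QuantumLattice hiding torusNorm
open Literature.MathematicalPhysics.QuantumFieldTheory hiding ZdEdge
open Literature.MathematicalPhysics.QuantumFieldTheory.Balaban1983to89.StrongCouplingTorusWindow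

namespace Summit.Ventures.YMGap.RobustBall

variable {d L N : ℕ} [NeZero L]

/-! ### The perturbed torus energy: measurability, boundedness; the specification -/

section Spec

variable (W : Perturbation d L N) (β : ℝ)

/-- The perturbed torus energy `∑_q log v_β(U_q) − W(U)` is measurable. [folklore] -/
theorem measurable_perturbedTorusEnergy :
    Measurable fun U : GaugeConfig d L (SUN N) => torusLogWeight (wilsonPlaqWeight N β) U - W.total U :=
  (measurable_torusLogWeight (continuous_wilsonPlaqWeight β)).sub W.measurable_total

/-- The perturbed torus energy is bounded (compact group, bounded activities). [folklore] -/
theorem exists_abs_perturbedTorusEnergy_le :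
    ∃ C, ∀ U : GaugeConfig d L (SUN N), |torusLogWeight (wilsonPlaqWeight N β) U - W.total U| ≤ C := by
  obtain ⟨B, hB⟩ := exists_abs_torusLogWeight_le (d := d) (L := L)
    (continuous_wilsonPlaqWeight (N := N) β) (wilsonPlaqWeight_pos β)
  obtain ⟨C, hC⟩ := W.exists_abs_total_le
  exact ⟨B + C, fun U => (abs_sub _ _).trans (add_le_add (hB U) (hC U))⟩

/-- **The perturbed torus specification is a specification** (probability kernels, outside
measurability, properness, consistency): the tree's generic Gibbsian-specification theorem
`isSpecification_tilted_map_glueWith_pi` with the volume-independent bounded measurable energy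
`∑_q log v_β(U_q) − W(U)` (Georgii 2011, Def. 2.9; Friedli–Velenik 2017, §6.10.1). [folklore] -/
theorem isSpecification_perturbedTorusSpec : IsSpecification (perturbedTorusSpec W β) := by
  haveI : NeZero (haarProbability (SUN N)) := ⟨IsProbabilityMeasure.ne_zero _⟩
  obtain ⟨C, hC⟩ := exists_abs_perturbedTorusEnergy_le W β
  exact isSpecification_tilted_map_glueWith_pi (V := Edge d L) (S := SUN N) (haarProbability (SUN N))
    (φ := fun _ => fun U => torusLogWeight (wilsonPlaqWeight N β) U - W.total U)
    (fun _ => measurable_perturbedTorusEnergy W β) (fun _ => ⟨C, hC⟩) (fun _ _ _ σ σ' _ => by simp)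

/-- `∑_q log v_β(U_q) = −β S_W(U)` for the Wilson plaquette weight of `SU(N)` at tree coupling `β`. [folklore] -/
theorem torusLogWeight_wilsonPlaqWeight (U : GaugeConfig d L (SUN N)) :
    torusLogWeight (wilsonPlaqWeight N β) U = -β * wilsonAction (fundamentalRep (Fin N)) U := by
  simp only [torusLogWeight, log_wilsonPlaqWeight, wilsonAction, fundamentalRep_apply, Finset.mul_sum,
    Finset.sum_neg_distrib, neg_mul]

/-- **The member's torus measure is the Haar tilt by the perturbed energy**:
`Z⁻¹ exp(−β S_W − W) ∏ dU_e = (∏ dU_e).tilted (∑_q log v_β(U_q) − W)`. [folklore] -/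
theorem perturbedMeasure_eq_tilted :
    W.perturbedMeasure (fundamentalRep (Fin N)) β =
      (Measure.pi fun _ : Edge d L => haarProbability (SUN N)).tilted
        fun U => torusLogWeight (wilsonPlaqWeight N β) U - W.total U := by
  set μ0 : Measure (GaugeConfig d L (SUN N)) := Measure.pi fun _ : Edge d L => haarProbability (SUN N) with hμ0
  set F : GaugeConfig d L (SUN N) → ℝ := fun U => torusLogWeight (wilsonPlaqWeight N β) U - W.total U with hF
  have hW : (fun U : GaugeConfig d L (SUN N) =>
      ENNReal.ofReal (Real.exp (-β * wilsonAction (fundamentalRep (Fin N)) U - W.total U))) =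
      fun U => ENNReal.ofReal (Real.exp (F U)) := by
    funext U; rw [hF]; dsimp only; rw [torusLogWeight_wilsonPlaqWeight]
  have hFm : Measurable F := measurable_perturbedTorusEnergy W β
  have hexpm : Measurable fun U => Real.exp (F U) := Real.measurable_exp.comp hFm
  have hmeas : Measurable fun U : GaugeConfig d L (SUN N) => ENNReal.ofReal (Real.exp (F U)) :=
    ENNReal.measurable_ofReal.comp hexpm
  obtain ⟨C, hC⟩ := exists_abs_perturbedTorusEnergy_le W β
  haveI : IsProbabilityMeasure μ0 := by rw [hμ0]; infer_instance
  have hbound : ∀ U, ‖Real.exp (F U)‖ ≤ Real.exp C := fun U => by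
    rw [Real.norm_eq_abs, abs_of_pos (Real.exp_pos _)]
    exact Real.exp_le_exp.2 (le_of_abs_le (hC U))
  have hint : Integrable (fun U => Real.exp (F U)) μ0 :=
    Integrable.of_bound hexpm.aestronglyMeasurable (Real.exp C) (Filter.Eventually.of_forall hbound)
  have hZpos : 0 < ∫ U, Real.exp (F U) ∂μ0 := integral_exp_pos hint
  have huniv : (μ0.withDensity fun U => ENNReal.ofReal (Real.exp (F U))) Set.univ =
      ENNReal.ofReal (∫ U, Real.exp (F U) ∂μ0) := by
    rw [withDensity_apply _ MeasurableSet.univ, Measure.restrict_univ,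
      ofReal_integral_eq_lintegral_ofReal hint (Filter.Eventually.of_forall fun U => (Real.exp_pos _).le)]
  unfold QuasiLocalGaugePerturbation.perturbedMeasure QuasiLocalGaugePerturbation.partitionFunction
    QuasiLocalGaugePerturbation.weight
  rw [← hμ0, hW, huniv, Measure.tilted]
  have hdens : (fun U : GaugeConfig d L (SUN N) => ENNReal.ofReal (Real.exp (F U) / ∫ U, Real.exp (F U) ∂μ0)) =
      (ENNReal.ofReal (∫ U, Real.exp (F U) ∂μ0))⁻¹ • fun U => ENNReal.ofReal (Real.exp (F U)) := by
    funext U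
    rw [Pi.smul_apply, smul_eq_mul, ENNReal.ofReal_div_of_pos hZpos, div_eq_mul_inv, mul_comm]
  rw [hdens, withDensity_smul _ hmeas]

/-- **In the full volume the perturbed torus kernel is the member's torus measure**, whatever the
boundary condition: `γ^{W,β}_{edges}(· | η) = μ_{β,W,L}`. [folklore] -/
theorem perturbedTorusSpec_univ (η : GaugeConfig d L (SUN N)) :
    perturbedTorusSpec W β Finset.univ η = W.perturbedMeasure (fundamentalRep (Fin N)) β := by
  rw [perturbedMeasure_eq_tilted, perturbedTorusSpec,
    Literature.MathematicalPhysics.QuantumFieldTheory.map_glueWith_univ_pi]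

/-- **DLR equations on the torus for the member**: `μ_{β,W,L}` is a Gibbs measure of the perturbed
torus specification (for a finite system the DLR equation in the volume `Λ` is the consistency
`γ_{edges} γ_Λ = γ_{edges}`; Georgii 2011, Def. 1.23 / Rem. 1.24). [folklore] -/
theorem isGibbsMeasure_perturbedMeasure :
    IsGibbsMeasure (perturbedTorusSpec W β) (W.perturbedMeasure (fundamentalRep (Fin N)) β) := by
  classical
  have hγ := isSpecification_perturbedTorusSpec W β
  obtain ⟨η⟩ : Nonempty (GaugeConfig d L (SUN N)) := ⟨fun _ => 1⟩
  rw [← perturbedTorusSpec_univ W β η]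
  refine ⟨hγ.isProbability _ _, fun Λ A hA => ?_⟩
  exact hγ.consistent (Finset.subset_univ Λ) η A hA

/-- The member's torus measure is a probability measure (a `theorem`, not an `instance`: use `haveI`). [folklore] -/
theorem isProbabilityMeasure_perturbedMeasure :
    IsProbabilityMeasure (W.perturbedMeasure (fundamentalRep (Fin N)) β) :=
  (isGibbsMeasure_perturbedMeasure W β).isProbabilityMeasure

end Spec

/-! ### U0: the one-link law of the perturbed torus specification -/

section OneLink

variable (W : Perturbation d L N) (β : ℝ)

/-- **The one-link law of the perturbed torus specification is a tilted Haar measure**: the law of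
`U_e` under `γ^{W,β}_{e}(· | ω)` is `σ_N.tilted (g ↦ ∑_q log v_β((ω^{e←g})_q) − W(ω^{e←g}))`
(rb-p1's generic `siteLaw_tilted_map_glueWith_pi`). [folklore] -/
theorem siteLaw_perturbedTorusSpec_eq_tilted_haar (e : Edge d L) (ω : GaugeConfig d L (SUN N)) :
    siteLaw (perturbedTorusSpec W β) e ω =
      (haarProbability (SUN N)).tilted fun g =>
        torusLogWeight (wilsonPlaqWeight N β) (update ω e g) - W.total (update ω e g) := by
  classical
  exact siteLaw_tilted_map_glueWith_pi (haarProbability (SUN N))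
    (fun _ => fun U => torusLogWeight (wilsonPlaqWeight N β) U - W.total U) e
    (measurable_perturbedTorusEnergy W β) ω

/-- Membership in `polymersThroughEdge`: at block scale `1` the links of `X` are the links based in `X`. [folklore] -/
theorem mem_polymersThroughEdge {e : Edge d L} {X : Finset (Site d L)} :
    X ∈ polymersThroughEdge e ↔ X ∈ polymers (d := d) (L := L) 1 ∧ e.1 ∈ X := by
  simp [polymersThroughEdge]

/-- At block scale `1`, `y` is a link of `X` iff its base point lies in `X`. [folklore] -/
theorem mem_polymerEdges_one {y : Edge d L} {X : Finset (Site d L)} : y ∈ polymerEdges 1 X ↔ y.1 ∈ X := by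
  simp

/-- An activity whose polymer has no link at `e` does not see the link `e`. [folklore] -/
theorem act_update_of_not_mem {X : Finset (Site d L)} {e : Edge d L} (he : e.1 ∉ X)
    (ω : GaugeConfig d L (SUN N)) (g : SUN N) : W.act X (update ω e g) = W.act X ω :=
  W.dependsOn X fun z hz => by
    rw [update_of_ne]
    rintro rfl
    exact he (mem_polymerEdges_one.1 (Finset.mem_coe.1 hz))

/-- **The total perturbation splits at a link**: `W(ω^{e←g}) = (∑_{X ∌ e} W_X(ω)) + h_{W,e,ω}(g)` — the
polymers without a link at `e` contribute a `g`-independent constant. [folklore] -/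
theorem total_update_eq (e : Edge d L) (ω : GaugeConfig d L (SUN N)) (g : SUN N) :
    W.total (update ω e g) =
      (∑ X ∈ (polymers (d := d) (L := L) 1).filter (fun X => e.1 ∉ X), W.act X ω) + localTilt W e ω g := by
  classical
  unfold QuasiLocalGaugePerturbation.total localTilt polymersThroughEdge
  rw [← Finset.sum_filter_add_sum_filter_not (polymers 1) (fun X : Finset (Site d L) => e.1 ∉ X)]
  congr 1
  · exact Finset.sum_congr rfl fun X hX => act_update_of_not_mem W (Finset.mem_filter.1 hX).2 ω g
  · refine Finset.sum_congr ?_ fun _ _ => rfl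
    ext X
    simp

/-- **U0 — the one-link law of the perturbed `SU(N)` torus theory in 't Hooft form**: for side
`L ≥ 2`, the law of `U_e` under `γ^{W,β}_{e}(· | ω)` is the Wilson one-link law
`ν_{B_ω}(dg) ∝ exp(N Re tr(g B_ω)) dg` (`B_ω = tField β e ω`) re-weighted by `exp(−h_{W,e,ω})`:
`(σ_N.tilted (N Re tr(· B_ω))).tilted (−localTilt W e ω)`. The one-link Wilson energy is
`const + N Re tr(g B_ω)` (`localLogWeight_update_eq`), the perturbation is `const + h_{W,e,ω}(g)`
(`total_update_eq`), and tilting forgets additive constants. [folklore] -/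
theorem siteLaw_perturbedTorusSpec_thooft (hL : 1 < L) (hN : 1 ≤ N) (e : Edge d L)
    (ω : GaugeConfig d L (SUN N)) :
    siteLaw (perturbedTorusSpec W β) e ω =
      ((haarProbability (SUN N)).tilted
        fun g => (N : ℝ) * ((g : Matrix (Fin N) (Fin N) ℂ) * tField β e ω).trace.re).tilted
        fun g => -localTilt W e ω g := by
  classical
  rw [siteLaw_perturbedTorusSpec_eq_tilted_haar]
  set c₁ : ℝ := ∑ q ∈ (plaqsThrough e)ᶜ,
    Real.log (wilsonPlaqWeight N β (plaquetteHolonomy ω q.1 q.2.1.1 q.2.1.2)) with hc₁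
  set c₂ : ℝ := -(β * N * (plaqsThrough e).card) with hc₂
  set c₃ : ℝ := ∑ X ∈ (polymers (d := d) (L := L) 1).filter (fun X => e.1 ∉ X), W.act X ω with hc₃
  set lin : SUN N → ℝ := fun g => (N : ℝ) * ((g : Matrix (Fin N) (Fin N) ℂ) * tField β e ω).trace.re
    with hlin
  have hsplit : (fun g : SUN N =>
      torusLogWeight (wilsonPlaqWeight N β) (update ω e g) - W.total (update ω e g)) =
      fun g => (c₁ + c₂ - c₃) + (lin g + -localTilt W e ω g) := by
    funext g
    rw [torusLogWeight_update_eq, localLogWeight_update_eq hL hN β e ω g, total_update_eq]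
    simp only [hlin]
    ring
  rw [hsplit, tilted_const_add_eq]
  obtain ⟨hm, hM⟩ := OneLinkTiltStability.su_linear_potential_measurable_bounded (N := N) (tField β e ω)
  have hint : Integrable (fun g : SUN N => Real.exp (lin g)) (haarProbability (SUN N)) := by
    refine Integrable.of_bound (Real.measurable_exp.comp hm).aestronglyMeasurable
      (Real.exp ((N : ℝ) * (Real.sqrt N * frobNorm (tField β e ω)))) (Filter.Eventually.of_forall fun g => ?_)
    rw [Real.norm_eq_abs, abs_of_pos (Real.exp_pos _)]
    exact Real.exp_le_exp.2 (le_of_abs_le (hM g))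
  rw [tilted_tilted hint]
  rfl

/-- **Target U0 holds.** [folklore] -/
theorem siteLawTarget_holds : SiteLawTarget N d :=
  fun _ _ hL hN β W e η => siteLaw_perturbedTorusSpec_thooft W β hL hN e η

/-! ### U0′: the loads control the local re-weighting function -/

variable {W}

omit [NeZero L] in
/-- Two configurations updated at `e` by different group elements agree off `e`. [folklore] -/
theorem update_eq_update_off (η : GaugeConfig d L (SUN N)) (e : Edge d L) (g g' : SUN N) :
    ∀ z, z ≠ e → update η e g z = update η e g' z := fun z hz => by
  rw [update_of_ne hz, update_of_ne hz]

/-- **Oscillation of the re-weighting function** `≤ a(e) = oscLoad 0 e`. [folklore] -/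
theorem localTilt_sub_le_oscLoad (w : LoadWitness W) (e : Edge d L) (η : GaugeConfig d L (SUN N))
    (g g' : SUN N) : localTilt W e η g - localTilt W e η g' ≤ w.oscLoad 0 e := by
  unfold localTilt LoadWitness.oscLoad
  rw [← Finset.sum_sub_distrib]
  refine Finset.sum_le_sum fun X _ => ?_
  rw [zero_mul, Real.exp_zero, one_mul]
  have h := (w.osc_spec X).le e (update η e g) (update η e g') (update_eq_update_off η e g g')
  exact (le_abs_self _).trans h

/-- **Lipschitz constant of the re-weighting function in the link variable** `≤ ℓ_s(e) = selfLipLoad 0 e`. [folklore] -/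
theorem abs_localTilt_sub_le_selfLipLoad (w : LoadWitness W) (e : Edge d L) (η : GaugeConfig d L (SUN N))
    (g g' : SUN N) : |localTilt W e η g - localTilt W e η g'| ≤ w.selfLipLoad 0 e * suFrobDist g g' := by
  unfold localTilt LoadWitness.selfLipLoad
  rw [← Finset.sum_sub_distrib, Finset.sum_mul]
  refine (Finset.abs_sum_le_sum_abs _ _).trans (Finset.sum_le_sum fun X _ => ?_)
  rw [zero_mul, Real.exp_zero, one_mul]
  have h := (w.lip_spec X).le e (update η e g) (update η e g') (update_eq_update_off η e g g')
  simpa using h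

/-- **Cross dependence of the re-weighting function**: for boundary conditions `ω = η` off a link
`y ≠ e`, `|h_ω(g) − h_η(g)| ≤ ℓ(e,y) · ‖ω_y − η_y‖_F` with `ℓ(e,y) = crossLip 0 e y` — only the polymers
through BOTH `e` and `y` see the difference. [folklore] -/
theorem abs_localTilt_sub_localTilt_le_crossLip (w : LoadWitness W) {e y : Edge d L} (hye : y ≠ e)
    {ω η : GaugeConfig d L (SUN N)} (hωη : ∀ z, z ≠ y → ω z = η z) (g : SUN N) :
    |localTilt W e ω g - localTilt W e η g| ≤ w.crossLip 0 e y * suFrobDist (ω y) (η y) := by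
  classical
  unfold localTilt LoadWitness.crossLip
  rw [← Finset.sum_sub_distrib, Finset.sum_mul]
  have hupd : ∀ z, z ≠ y → update ω e g z = update η e g z := fun z hz => by
    by_cases hze : z = e
    · subst hze; simp
    · rw [update_of_ne hze, update_of_ne hze, hωη z hz]
  -- the polymers without a link at `y` do not contribute
  have hzero : ∀ X ∈ polymersThroughEdge e, X ∉ (polymersThroughEdge e).filter (fun X => y ∈ polymerEdges 1 X) →
      W.act X (update ω e g) - W.act X (update η e g) = 0 := by
    intro X hX hXy
    have hy : y ∉ polymerEdges 1 X := fun h => hXy (Finset.mem_filter.2 ⟨hX, h⟩)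
    rw [sub_eq_zero]
    exact W.dependsOn X fun z hz => hupd z (by rintro rfl; exact hy (Finset.mem_coe.1 hz))
  rw [← Finset.sum_subset (Finset.filter_subset _ _) hzero]
  refine (Finset.abs_sum_le_sum_abs _ _).trans (Finset.sum_le_sum fun X _ => ?_)
  rw [zero_mul, Real.exp_zero, one_mul]
  have h := (w.lip_spec X).le y (update ω e g) (update η e g) hupd
  rwa [update_of_ne hye, update_of_ne hye] at h

/-- **Target U0′ holds.** [folklore] -/
theorem localTiltLoadsTarget_holds : LocalTiltLoadsTarget N d :=
  fun _ _ _ w e => ⟨fun η g g' => localTilt_sub_le_oscLoad w e η g g',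
    fun η g g' => abs_localTilt_sub_le_selfLipLoad w e η g g',
    fun _ hye _ _ hωη g => abs_localTilt_sub_localTilt_le_crossLip w hye hωη g⟩

variable (W)

/-- The re-weighting function is measurable in the link variable. [folklore] -/
@[fun_prop] theorem measurable_localTilt (e : Edge d L) (η : GaugeConfig d L (SUN N)) :
    Measurable (localTilt W e η) := by
  unfold localTilt
  exact Finset.measurable_sum _ fun X _ => (W.measurable_act X).comp (measurable_update η)

/-- The re-weighting function is bounded, uniformly in the boundary condition. [folklore] -/
theorem exists_abs_localTilt_le (e : Edge d L) :
    ∃ M, ∀ (η : GaugeConfig d L (SUN N)) (g : SUN N), |localTilt W e η g| ≤ M := by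
  choose C hC using W.bounded'
  refine ⟨∑ X ∈ polymersThroughEdge e, C X, fun η g => ?_⟩
  unfold localTilt
  exact (Finset.abs_sum_le_sum_abs _ _).trans (Finset.sum_le_sum fun X _ => hC X _)

variable {W}

/-- Oscillation witnesses are nonnegative, hence so is every weighted oscillation load. [folklore] -/
theorem oscLoad_nonneg (w : LoadWitness W) (κ : ℝ) (e : Edge d L) : 0 ≤ w.oscLoad κ e :=
  Finset.sum_nonneg fun X _ => mul_nonneg (Real.exp_pos _).le ((w.osc_spec X).nonneg e)

/-- Lipschitz witnesses are nonnegative, hence so is every weighted self-Lipschitz load. [folklore] -/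
theorem selfLipLoad_nonneg (w : LoadWitness W) (κ : ℝ) (e : Edge d L) : 0 ≤ w.selfLipLoad κ e :=
  Finset.sum_nonneg fun X _ => mul_nonneg (Real.exp_pos _).le ((w.lip_spec X).nonneg e)

/-- Every weighted cross-Lipschitz coefficient is nonnegative. [folklore] -/
theorem crossLip_nonneg (w : LoadWitness W) (κ : ℝ) (e y : Edge d L) : 0 ≤ w.crossLip κ e y :=
  Finset.sum_nonneg fun X _ => mul_nonneg (Real.exp_pos _).le ((w.lip_spec X).nonneg y)

/-- Every weighted cross-Lipschitz load is nonnegative. [folklore] -/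
theorem crossLipLoad_nonneg (w : LoadWitness W) (κ : ℝ) (e : Edge d L) : 0 ≤ w.crossLipLoad κ e :=
  Finset.sum_nonneg fun y _ => crossLip_nonneg w κ e y

/-- Loads are monotone in the weight: `a_0(e) ≤ a_κ(e)` for `κ ≥ 0` (`e^{κ diam X} ≥ 1`). [folklore] -/
theorem oscLoad_zero_le (w : LoadWitness W) {κ : ℝ} (hκ : 0 ≤ κ) (e : Edge d L) :
    w.oscLoad 0 e ≤ w.oscLoad κ e := by
  refine Finset.sum_le_sum fun X _ => mul_le_mul_of_nonneg_right ?_ ((w.osc_spec X).nonneg e)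
  rw [zero_mul]
  exact Real.exp_le_exp.2 (mul_nonneg hκ (Nat.cast_nonneg _))

/-- `ℓ_{s,0}(e) ≤ ℓ_{s,κ}(e)` for `κ ≥ 0`. [folklore] -/
theorem selfLipLoad_zero_le (w : LoadWitness W) {κ : ℝ} (hκ : 0 ≤ κ) (e : Edge d L) :
    w.selfLipLoad 0 e ≤ w.selfLipLoad κ e := by
  refine Finset.sum_le_sum fun X _ => mul_le_mul_of_nonneg_right ?_ ((w.lip_spec X).nonneg e)
  rw [zero_mul]
  exact Real.exp_le_exp.2 (mul_nonneg hκ (Nat.cast_nonneg _))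

end OneLink

end Summit.Ventures.YMGap.RobustBall

end
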